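import Mathlib
import Summits.Ventures.PercRepro2.Graph
import Summits.Ventures.PercRepro2.Exploration
import Summits.Ventures.PercRepro2.Harris
import Summits.Ventures.PercRepro2.GibbsPAJoint
import Summits.Ventures.PercRepro2.SepClusterJoint
import Summits.Ventures.PercRepro2.SepClusterSupport
import Summits.Ventures.PercRepro2.SepClusterHarris
import Summits.Ventures.PercRepro2.SepFamJoint

/-!
# The separated clusters of a family of roots — the support and the conditional expectations
(blind cell PercRepro2, p3 g12, 2026-08-27; `proofs/P3-G2.md` §2, Lemma 4, root sets)

The multi-root form of `SepClusterSupport`: with edge weights in `(0, 1)` and `X`, `Y`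
disjoint, a tuple is in the support of a marginal of `Jf` iff it is the explored tuple of some
separated configuration; the tuple explored away from the footprint of a supported tuple of the
other family is again in the support (`explAway_mem_support_right/left`); and the two
conditional expectations of the Gibbs sampler are expectations of the other family's tuple
explored away from the conditioning footprint (`condS_eq_expect_fam`,
`condS_transpose_eq_expect_fam`).  Own work; standard axioms.
-/

namespace Summit.Ventures.PercRepro2

namespace SepPA

open Finset Classical

section FamilySupport

variable {V : Type*} {E : Type*} [Fintype V] [Fintype E] [DecidableEq E]
variable (ends : E → Sym2 V) (p : E → ℝ) (X Y : Finset V)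

/-- The tuple of the clusters of the roots `Y` explored away from the set `F`. -/
noncomputable def explAway (F : Set V) (ω : Config E) : Y → Set V :=
  fun y => clAway ends F y ω

variable {X Y}

omit [Fintype V] [Fintype E] [DecidableEq E] in
/-- The all-closed configuration is separated for disjoint families. -/
lemma allFalse_mem_sepFam (hXY : Disjoint X Y) :
    (fun _ => false : Config E) ∈ sepFam ends X Y := by
  intro x hx y hy h
  have hc : cluster ends (fun _ => false) x = {x} :=
    cluster_eq_singleton_of_closed (fun _ _ => rfl)
  have : y ∈ cluster ends (fun _ => false) x := h
  rw [hc, Set.mem_singleton_iff] at this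
  exact Finset.disjoint_left.mp hXY hx (this ▸ hy)

omit [Fintype V] in
/-- `P(X ↮ Y) > 0` for disjoint families (interior weights). -/
lemma prob_sepFam_pos (hp01 : ∀ e, 0 < p e ∧ p e < 1) (hXY : Disjoint X Y) :
    0 < prob p (sepFam ends X Y) :=
  prob_pos_of_mem p hp01 (allFalse_mem_sepFam ends hXY)

/-- A separated configuration with `expl Y = t` puts `t` in the support of the `Y`-marginal. -/
lemma sum_Jf_right_ne_zero (hp01 : ∀ e, 0 < p e ∧ p e < 1) (hXY : Disjoint X Y)
    {t : Y → Set V} {ω : Config E} (hω : ω ∈ explEvent ends Y t ∩ sepFam ends X Y) :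
    (∑ k, Jf ends p X Y t k) ≠ 0 := by
  rw [sum_Jf_right]
  exact div_ne_zero (ne_of_gt (prob_pos_of_mem p hp01 hω))
    (ne_of_gt (prob_sepFam_pos ends p hp01 hXY))

/-- A separated configuration with `expl X = k` puts `k` in the support of the `X`-marginal. -/
lemma sum_Jf_left_ne_zero (hp01 : ∀ e, 0 < p e ∧ p e < 1) (hXY : Disjoint X Y)
    {k : X → Set V} {ω : Config E} (hω : ω ∈ explEvent ends X k ∩ sepFam ends X Y) :
    (∑ t, Jf ends p X Y t k) ≠ 0 := by
  rw [sum_Jf_left]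
  exact div_ne_zero (ne_of_gt (prob_pos_of_mem p hp01 hω))
    (ne_of_gt (prob_sepFam_pos ends p hp01 hXY))

/-- A tuple in the support of the `Y`-marginal is explored by some separated configuration. -/
lemma exists_mem_of_sum_Jf_right_ne_zero {t : Y → Set V} (ht : (∑ k, Jf ends p X Y t k) ≠ 0) :
    ∃ ω, ω ∈ explEvent ends Y t ∩ sepFam ends X Y := by
  by_contra h
  apply ht
  rw [sum_Jf_right]
  have : explEvent ends Y t ∩ sepFam ends X Y = ∅ := by
    ext ω
    simp only [Set.mem_empty_iff_false, iff_false]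
    exact fun hω => h ⟨ω, hω⟩
  rw [this, prob_empty, zero_div]

/-- A tuple in the support of the `X`-marginal is explored by some separated configuration. -/
lemma exists_mem_of_sum_Jf_left_ne_zero {k : X → Set V} (hk : (∑ t, Jf ends p X Y t k) ≠ 0) :
    ∃ ω, ω ∈ explEvent ends X k ∩ sepFam ends X Y := by
  by_contra h
  apply hk
  rw [sum_Jf_left]
  have : explEvent ends X k ∩ sepFam ends X Y = ∅ := by
    ext ω
    simp only [Set.mem_empty_iff_false, iff_false]
    exact fun hω => h ⟨ω, hω⟩
  rw [this, prob_empty, zero_div]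

omit [Fintype V] [Fintype E] [DecidableEq E] in
/-- In the graph with the edges touching `F ⊇ X` removed, every root of `X` is isolated, so the
restricted configuration is separated from any family disjoint from `X`. -/
lemma restrict_mem_sepFam (hXY : Disjoint X Y) {F : Set V} (hF : ∀ x ∈ X, x ∈ F)
    (ω : Config E) : restrict (touches ends F)ᶜ ω ∈ sepFam ends X Y := by
  intro x hx y hy h
  have hc : cluster ends (restrict (touches ends F)ᶜ ω) x = {x} :=
    clAway_self_eq_singleton ends (hF x hx) ω
  have : y ∈ cluster ends (restrict (touches ends F)ᶜ ω) x := h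
  rw [hc, Set.mem_singleton_iff] at this
  exact Finset.disjoint_left.mp hXY hx (this ▸ hy)

/-- The `Y`-tuple explored away from a supported `X`-tuple is in the support. -/
lemma explAway_mem_support_right (hp01 : ∀ e, 0 < p e ∧ p e < 1) (hXY : Disjoint X Y)
    {k : X → Set V} (hk : (∑ t, Jf ends p X Y t k) ≠ 0) (ω : Config E) :
    (∑ k', Jf ends p X Y (explAway ends Y (foot k) ω) k') ≠ 0 := by
  obtain ⟨ω₀, hω₀⟩ := exists_mem_of_sum_Jf_left_ne_zero ends p hk
  apply sum_Jf_right_ne_zero ends p hp01 hXY (ω := restrict (touches ends (foot k))ᶜ ω)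
  refine ⟨fun y => rfl, ?_⟩
  exact restrict_mem_sepFam ends hXY (fun x hx => mem_foot_of_mem_explEvent hω₀.1 ⟨x, hx⟩) ω

/-- The `X`-tuple explored away from a supported `Y`-tuple is in the support. -/
lemma explAway_mem_support_left (hp01 : ∀ e, 0 < p e ∧ p e < 1) (hXY : Disjoint X Y)
    {t : Y → Set V} (ht : (∑ k, Jf ends p X Y t k) ≠ 0) (ω : Config E) :
    (∑ t', Jf ends p X Y t' (explAway ends X (foot t) ω)) ≠ 0 := by
  obtain ⟨ω₀, hω₀⟩ := exists_mem_of_sum_Jf_right_ne_zero ends p ht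
  apply sum_Jf_left_ne_zero ends p hp01 hXY (ω := restrict (touches ends (foot t))ᶜ ω)
  refine ⟨fun x => rfl, ?_⟩
  -- every root of `Y` is isolated in the restricted configuration
  intro x hx y hy h
  have hc : cluster ends (restrict (touches ends (foot t))ᶜ ω) y = {y} :=
    clAway_self_eq_singleton ends (mem_foot_of_mem_explEvent hω₀.1 ⟨y, hy⟩) ω
  have : x ∈ cluster ends (restrict (touches ends (foot t))ᶜ ω) y := conn_symm h
  rw [hc, Set.mem_singleton_iff] at this
  exact Finset.disjoint_left.mp hXY hx (this ▸ hy)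

/-- The conditional expectation given a supported `X`-tuple `k`. -/
theorem condS_eq_expect_fam (hp01 : ∀ e, 0 < p e ∧ p e < 1) (hXY : Disjoint X Y)
    (g : (Y → Set V) → ℝ) {k : X → Set V} (hk : (∑ t, Jf ends p X Y t k) ≠ 0) :
    GibbsPAJoint.condS (Jf ends p X Y) g k =
      expect p (fun ω => g (explAway ends Y (foot k) ω)) := by
  obtain ⟨ω₀, hω₀⟩ := exists_mem_of_sum_Jf_left_ne_zero ends p hk
  have hY : ∀ y ∈ Y, y ∉ foot k := by
    intro y hy
    -- the roles of `X` and `Y` exchanged in `not_mem_foot_of_sepFam`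
    rintro ⟨x, hx⟩
    apply hω₀.2 x x.2 y hy
    rw [← hω₀.1 x] at hx
    exact hx
  have hsub : explEvent ends X k ∩ sepFam ends X Y = explEvent ends X k := by
    apply Set.inter_eq_left.mpr
    intro ω hω x hx y hy h
    apply hY y hy
    refine ⟨⟨x, hx⟩, ?_⟩
    rw [← hω ⟨x, hx⟩]
    exact h
  have hpos : prob p (explEvent ends X k) ≠ 0 := by
    rw [← hsub]
    exact ne_of_gt (prob_pos_of_mem p hp01 hω₀)
  have hS : prob p (sepFam ends X Y) ≠ 0 := ne_of_gt (prob_sepFam_pos ends p hp01 hXY)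
  unfold GibbsPAJoint.condS
  rw [sum_Jf_left, hsub]
  have hpush : expect p (fun ω => g (explAway ends Y (foot k) ω)) =
      ∑ t, prob p {ω | explAway ends Y (foot k) ω = t} * g t := by
    have h := expect_indicator_comp_eq_sum p Set.univ (fun ω => explAway ends Y (foot k) ω) g
    simp only [Set.indicator_univ, one_mul, Set.univ_inter] at h
    exact h
  rw [hpush]
  have hJ : ∀ t, Jf ends p X Y t k * g t =
      (prob p (explEvent ends X k) / prob p (sepFam ends X Y)) *
        (prob p {ω | explAway ends Y (foot k) ω = t} * g t) := by
    intro t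
    unfold Jf
    rw [prob_joint_fam' ends p X Y hY t]
    have : {ω | ∀ y : Y, clAway ends (foot k) y ω = t y} =
        {ω | explAway ends Y (foot k) ω = t} := by
      ext ω
      simp only [Set.mem_setOf_eq]
      constructor
      · intro h; funext y; exact h y
      · intro h y; exact congrFun h y
    rw [this]
    ring
  simp_rw [hJ]
  rw [← Finset.mul_sum]
  field_simp

/-- The conditional expectation given a supported `Y`-tuple `t`. -/
theorem condS_transpose_eq_expect_fam (hp01 : ∀ e, 0 < p e ∧ p e < 1) (hXY : Disjoint X Y)
    (F : (X → Set V) → ℝ) {t : Y → Set V} (ht : (∑ k, Jf ends p X Y t k) ≠ 0) :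
    GibbsPAJoint.condS (GibbsPAJoint.transpose (Jf ends p X Y)) F t =
      expect p (fun ω => F (explAway ends X (foot t) ω)) := by
  obtain ⟨ω₀, hω₀⟩ := exists_mem_of_sum_Jf_right_ne_zero ends p ht
  have hX : ∀ x ∈ X, x ∉ foot t := fun x hx => not_mem_foot_of_sepFam hω₀.1 hω₀.2 hx
  have hsub : explEvent ends Y t ∩ sepFam ends X Y = explEvent ends Y t :=
    Set.inter_eq_left.mpr (fun ω hω => mem_sepFam_of_explEvent hω hX)
  have hpos : prob p (explEvent ends Y t) ≠ 0 := by
    rw [← hsub]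
    exact ne_of_gt (prob_pos_of_mem p hp01 hω₀)
  have hS : prob p (sepFam ends X Y) ≠ 0 := ne_of_gt (prob_sepFam_pos ends p hp01 hXY)
  unfold GibbsPAJoint.condS GibbsPAJoint.transpose
  rw [sum_Jf_right, hsub]
  have hpush : expect p (fun ω => F (explAway ends X (foot t) ω)) =
      ∑ k, prob p {ω | explAway ends X (foot t) ω = k} * F k := by
    have h := expect_indicator_comp_eq_sum p Set.univ (fun ω => explAway ends X (foot t) ω) F
    simp only [Set.indicator_univ, one_mul, Set.univ_inter] at h
    exact h
  rw [hpush]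
  have hJ : ∀ k, Jf ends p X Y t k * F k =
      (prob p (explEvent ends Y t) / prob p (sepFam ends X Y)) *
        (prob p {ω | explAway ends X (foot t) ω = k} * F k) := by
    intro k
    unfold Jf
    rw [prob_joint_fam ends p X Y hX k]
    have : {ω | ∀ x : X, clAway ends (foot t) x ω = k x} =
        {ω | explAway ends X (foot t) ω = k} := by
      ext ω
      simp only [Set.mem_setOf_eq]
      constructor
      · intro h; funext x; exact h x
      · intro h x; exact congrFun h x
    rw [this]
    ring
  simp_rw [hJ]
  rw [← Finset.mul_sum]
  field_simp

end FamilySupport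

end SepPA

end Summit.Ventures.PercRepro2
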